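import Summits.NavierStokesRegularity.NavierStokesRegularity.Theorems.HubbleDynamoNoSelfExcitedDynamoStubAlphaLimit
import Literature.Analysis.FluidPDE.AncientMildCompactness
import HarnessLib

/-!
# Crux `NoSelfExcitedDynamo` (stmt-NavierStokesRegularity-1934), line `registered`: sequential
  compactness of the eternal profile class with a uniform amplitude floor

Theorems file (lands `--supports stmt-NavierStokesRegularity-1934`; registered sub-goal
`stub_limitClosed`). Let `(W_n, Q_n)` be ETERNAL classical solutions of Leray's backward system
`∂ₛW + ½W + ½(y·∇)W + (W·∇)W + ∇Q = ΔW`, `div W = 0` on `ℝ × ℝ³`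
(`IsBackwardLeraySolutionOn univ 1 (W_n) (Q_n)`) with a UNIFORM `k = 0` profile bound
`(1 + ‖y‖)‖W_n(s, y)‖ ≤ K₀` and a uniform amplitude floor `δ > 0` at every similarity time
(`∀ n s, ∃ y, δ ≤ ‖W_n(s, y)‖`). Then a subsequence `W_{φ(j)}` converges, uniformly on every
compact `[−R, R] × B̄(0, R)` of `ℝ × ℝ³`, to an eternal solution `(W, Q)` in the full uniform
profile class `(1 + ‖y‖)^{k+1}‖DᵏW‖ ≤ K_k` with the same `k = 0` constant `K₀` and the same floor
`δ` at every time (`stub_limitClosed`). This is the proof of the one-orbit α-limit statement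
`stub_alphaLimit` run for an arbitrary sequence (KNSS 2009, Lemma 6.1):

1. the physical fields `u_n = ofLerayOrbit W_n` are classical on `(−∞, 0)` with the pointwise
   Type-I bound with constant `K₀` (`alphaLimit_physical`), hence continuous, weakly
   divergence-free, Oseen-mild between all pairs of negative times, with the rate
   `√(−t)‖u_n(t, x)‖ ≤ K₀` (`alphaLimit_oseen_of_classical`), all uniformly in `n`;
2. KNSS 2009, Lemma 6.1 in the tree's symmetry-free rate form `KNSS2009_lemma61_typeI_rate`
   extracts `φ` and a limit `w`: uniformly on the slab pieces `[−(m+2), −1/(m+2)] × B̄(0, m+2)`,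
   pointwise on the open slab, locally uniformly on every negative slice; the pointwise Type-I
   bound passes to the limit;
3. `w` is classical on `(−∞, 0)` with one pressure (`alphaLimit_classical_of_rate`), so
   `(W, Q) = (lerayOrbit w, lerayOrbitPressure q)` is eternal and in the profile class
   (`alphaLimit_profile`), with the `k = 0` bound `K₀` (`hasTypeIDecay_iff_lerayOrbit`);
4. the floor at similarity time `s` is read at the physical slice `t = −e^{−s}`: the floor points
   `y_n` of `W_n(s, ·)` obey `1 + ‖y_n‖ ≤ K₀/δ`, so `x_n = e^{−s/2}y_n` stay in a fixed ball, on
   which the convergence is uniform (`alphaLimit_floor`);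
5. the similarity compact `[−R, R] × B̄(0, R)` is mapped by `(s, y) ↦ (−e^{−s}, e^{−s/2}y)` into
   ONE slab piece (`limitClosed_window`), and `W_n(s, y) − W(s, y) = e^{−s/2}(u_n − w)(−e^{−s}, e^{−s/2}y)`
   with `e^{−s/2} ≤ e^{R/2}` there (dictionary `lerayOrbit ∘ ofLerayOrbit = id`), so uniform
   convergence on the slab piece is uniform convergence on the similarity compact.

## References

* G. Koch, N. Nadirashvili, G. Seregin, V. Šverák, *Liouville theorems for the Navier–Stokes
  equations and applications*, Acta Math. 203 (2009) 83–105 = arXiv:0709.3599, Lemma 6.1 and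
  proof of Thm 6.2. [KochNadirashviliSereginSverak2009]
-/

noncomputable section

-- the mandated stub namespace repeats `NavierStokesRegularity` (tree precedent for this crux's stubs)
set_option linter.dupNamespace false

namespace Summit.NavierStokesRegularity.NavierStokesRegularity.Theorems.NoSelfExcitedDynamo.Registered

open Set MeasureTheory Filter Topology Function Metric
open scoped ContDiff
open Literature.Analysis
open Literature.Analysis.FluidPDE

/-! ### Similarity compacts land in one slab piece -/

/-- **Similarity compacts land in one slab piece.** For `s ∈ [−R, R]`, `‖y‖ ≤ R` and a natural
number `m ≥ e^{R} + e^{R/2}R`, the physical point `(−e^{−s}, e^{−s/2}y)` lies in the slab piece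
`[−(m+2), −1/(m+2)] × B̄(0, m+2)`: indeed `e^{−R} ≤ e^{−s} ≤ e^{R} ≤ m + 2`, `1/(m+2) ≤ e^{−R}`, and
`‖e^{−s/2}y‖ ≤ e^{R/2}R ≤ m + 2`. -/
theorem limitClosed_window {R s : ℝ} (hs : s ∈ Icc (-R) R) {y : EuclideanSpace ℝ (Fin 3)}
    (hy : y ∈ closedBall (0 : EuclideanSpace ℝ (Fin 3)) R) {m : ℕ}
    (hm : Real.exp R + Real.exp (R / 2) * R ≤ m) :
    (-Real.exp (-s), Real.exp (-s / 2) • y) ∈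
      Icc (-((m : ℝ) + 2)) (-(1 / ((m : ℝ) + 2))) ×ˢ
        closedBall (0 : EuclideanSpace ℝ (Fin 3)) ((m : ℝ) + 2) := by
  have hR : 0 ≤ R := by linarith [hs.1, hs.2]
  have hyR : ‖y‖ ≤ R := by rwa [mem_closedBall, dist_zero_right] at hy
  have hpos : 0 ≤ Real.exp (R / 2) * R := mul_nonneg (Real.exp_pos _).le hR
  have heR : Real.exp R ≤ (m : ℝ) + 2 := by linarith
  have hes : Real.exp (-s) ≤ Real.exp R := Real.exp_le_exp.2 (by linarith [hs.1])
  have hes' : Real.exp (-R) ≤ Real.exp (-s) := Real.exp_le_exp.2 (by linarith [hs.2])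
  refine ⟨⟨by linarith, ?_⟩, ?_⟩
  · have h1 : 1 / ((m : ℝ) + 2) ≤ Real.exp (-R) := by
      rw [Real.exp_neg, ← one_div]
      exact one_div_le_one_div_of_le (Real.exp_pos R) heR
    linarith
  · rw [mem_closedBall, dist_zero_right, norm_smul, Real.norm_of_nonneg (Real.exp_pos _).le]
    have hes2 : Real.exp (-s / 2) ≤ Real.exp (R / 2) := Real.exp_le_exp.2 (by linarith [hs.1])
    calc Real.exp (-s / 2) * ‖y‖ ≤ Real.exp (R / 2) * R :=
          mul_le_mul hes2 hyR (norm_nonneg _) (Real.exp_pos _).le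
      _ ≤ (m : ℝ) + 2 := by linarith [Real.exp_pos R]

/-! ### The registered stub -/

/-- **Stub `stub_limitClosed`** (KNSS 2009, Lemma 6.1, sequential compactness of the eternal
profile class with a floor). Let `(W_n, Q_n)` be eternal classical solutions of Leray's backward
system with a uniform `k = 0` profile bound `(1 + ‖y‖)‖W_n(s, y)‖ ≤ K₀` and a uniform amplitude
floor `δ > 0` at every similarity time. Then a subsequence `W_{φ(j)}` converges, uniformly on
every compact `[−R, R] × B̄(0, R)` of `ℝ × ℝ³`, to an eternal profile-class solution `(W, Q)` with
the same `k = 0` bound and the same floor. Proof: the physical fields `u_n = ofLerayOrbit W_n` are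
classical Type-I fields on `(−∞, 0)` with constant `K₀` (`alphaLimit_physical`), hence
rate-bounded Oseen-mild fields (`alphaLimit_oseen_of_classical`); `KNSS2009_lemma61_typeI_rate`
extracts `φ` and a limit `w` (uniformly on slab pieces, pointwise, locally uniformly on slices);
`w` inherits the pointwise Type-I bound, is classical with one pressure
(`alphaLimit_classical_of_rate`), so `(W, Q) = (lerayOrbit w, lerayOrbitPressure q)` is eternal
and in the profile class (`alphaLimit_profile`, `hasTypeIDecay_iff_lerayOrbit`); the floor passes
to the limit on the slice `t = −e^{−s}` (`alphaLimit_floor`; floor points have `1 + ‖y‖ ≤ K₀/δ`);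
and each similarity compact lands in one slab piece (`limitClosed_window`), where
`W_n − W = e^{−s/2}(u_n − w) ∘ (s, y) ↦ (−e^{−s}, e^{−s/2}y)` with `e^{−s/2} ≤ e^{R/2}`. -/
theorem stub_limitClosed :
    ∀ (K₀ δ : ℝ) (Wn : ℕ → ℝ → EuclideanSpace ℝ (Fin 3) → EuclideanSpace ℝ (Fin 3))
      (Qn : ℕ → ℝ → EuclideanSpace ℝ (Fin 3) → ℝ),
      0 < δ →
      (∀ n, IsBackwardLeraySolutionOn univ 1 (Wn n) (Qn n)) →
      (∀ n s y, (1 + ‖y‖) * ‖Wn n s y‖ ≤ K₀) →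
      (∀ n s, ∃ y, δ ≤ ‖Wn n s y‖) →
      ∃ (φ : ℕ → ℕ) (W : ℝ → EuclideanSpace ℝ (Fin 3) → EuclideanSpace ℝ (Fin 3))
        (Q : ℝ → EuclideanSpace ℝ (Fin 3) → ℝ),
        StrictMono φ ∧ IsBackwardLeraySolutionOn univ 1 W Q ∧
        (∀ s y, (1 + ‖y‖) * ‖W s y‖ ≤ K₀) ∧
        (∀ k : ℕ, ∃ K : ℝ, ∀ s y, (1 + ‖y‖) ^ (k + 1) * ‖iteratedFDeriv ℝ k (W s) y‖ ≤ K) ∧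
        (∀ s, ∃ y, δ ≤ ‖W s y‖) ∧
        ∀ R : ℝ, TendstoUniformlyOn (fun j => Function.uncurry (Wn (φ j))) (Function.uncurry W) atTop
          (Icc (-R) R ×ˢ Metric.closedBall (0 : EuclideanSpace ℝ (Fin 3)) R) := by
  intro K₀ δ Wn Qn hδ hWn hK₀ hfl
  -- the physical fields `u n = ofLerayOrbit (Wn n)`: classical Type-I fields on `(-∞, 0)`
  obtain ⟨u, hu⟩ : ∃ u : ℕ → ℝ → EuclideanSpace ℝ (Fin 3) → EuclideanSpace ℝ (Fin 3),
      ∀ n, u n = ofLerayOrbit (Wn n) := ⟨_, fun n => rfl⟩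
  have hphys : ∀ n : ℕ,
      IsClassicalNSSolutionOn (Iio 0) 1 0 (u n) (ofLerayOrbitPressure (Qn n)) ∧
      HasTypeIDecay K₀ (u n) := fun n => by
    rw [hu n]
    exact alphaLimit_physical (hWn n) (hK₀ n)
  have hdec : ∀ n, HasTypeIDecay K₀ (u n) := fun n => (hphys n).2
  have hos : ∀ n : ℕ, ContinuousOn (uncurry (u n)) (Iio 0 ×ˢ univ) ∧
      (∀ t < 0, IsWeaklyDivFree (u n t)) ∧
      (∀ s t : ℝ, s < t → t < 0 → ∀ x, u n t x =
        UnboundedOperators.heatExtension (u n s) (t - s) x - oseenDuhamel 1 s (u n) (u n) t x) ∧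
      (∀ t < 0, ∀ x, Real.sqrt (-t) * ‖u n t x‖ ≤ K₀) := fun n =>
    alphaLimit_oseen_of_classical (hphys n).1 (hdec n)
  -- the dictionary: `Wn n s y = e^{-s/2} u_n(-e^{-s}, e^{-s/2} y)`
  have hdict : ∀ (n : ℕ) (s : ℝ) (y : EuclideanSpace ℝ (Fin 3)), Wn n s y =
      Real.exp (-s / 2) • u n (-Real.exp (-s)) (Real.exp (-s / 2) • y) := by
    intro n s y
    have h := congrFun (congrFun (lerayOrbit_ofLerayOrbit_eq (Wn n)) s) y
    rw [lerayOrbit_apply, ← hu n] at h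
    exact h.symm
  -- KNSS 2009, Lemma 6.1 (Type-I-rate form): a locally uniform limit of a subsequence
  have hA : Tendsto (fun k : ℕ => -((k : ℝ) + 1)) atTop atBot :=
    tendsto_neg_atTop_atBot.comp (tendsto_atTop_add_const_right _ _ tendsto_natCast_atTop_atTop)
  obtain ⟨φ, w, hφ, hwc, hwdiv, hwrate, hwmild, hunif, hpt, hloc⟩ :=
    KNSS2009_lemma61_typeI_rate (A := fun k : ℕ => -((k : ℝ) + 1)) (w := u) (C := K₀) hA
      (fun n => (hos n).1.mono (prod_mono (fun τ hτ => hτ.2) Subset.rfl))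
      (fun n t ht => (hos n).2.1 t ht.2)
      (fun n s t _ hst ht x => (hos n).2.2.1 s t hst ht x)
      (fun n τ hτ x => (hos n).2.2.2 τ hτ.2 x)
  -- the pointwise Type-I bound passes to the limit
  have hdecw : HasTypeIDecay K₀ w := fun t ht x =>
    le_of_tendsto (hpt t ht x).norm (Eventually.of_forall fun j => hdec (φ j) t ht x)
  -- the limit is classical with one pressure, its profile is eternal and in the profile class
  obtain ⟨q, hclw⟩ := alphaLimit_classical_of_rate hwc hwdiv hwmild hwrate
  obtain ⟨hW, hWprof⟩ := alphaLimit_profile hclw hdecw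
  refine ⟨φ, lerayOrbit w, lerayOrbitPressure q, hφ, hW, hasTypeIDecay_iff_lerayOrbit.1 hdecw,
    hWprof, fun s => ?_, fun R => ?_⟩
  · -- the floor at similarity time `s`, read at the physical slice `t = -e^{-s}`
    have ht : -Real.exp (-s) < 0 := neg_exp_neg_lt_zero s
    have hc : 0 < Real.exp (-s / 2) := Real.exp_pos _
    have hfl' : ∀ᶠ j in atTop, ∃ x ∈ closedBall (0 : EuclideanSpace ℝ (Fin 3))
        (Real.exp (-s / 2) * (K₀ / δ)), δ ≤ Real.exp (-s / 2) * ‖u (φ j) (-Real.exp (-s)) x‖ := by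
      refine Eventually.of_forall fun j => ?_
      obtain ⟨y, hy⟩ := hfl (φ j) s
      have hy1 : (1 + ‖y‖) * δ ≤ K₀ :=
        (mul_le_mul_of_nonneg_left hy (by positivity)).trans (hK₀ _ _ y)
      have hyR : ‖y‖ ≤ K₀ / δ := by
        rw [le_div_iff₀ hδ]
        nlinarith [norm_nonneg y]
      refine ⟨Real.exp (-s / 2) • y, ?_, ?_⟩
      · rw [mem_closedBall, dist_zero_right, norm_smul, Real.norm_of_nonneg hc.le]
        exact mul_le_mul_of_nonneg_left hyR hc.le
      · rw [hdict (φ j) s y, norm_smul, Real.norm_of_nonneg hc.le] at hy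
        exact hy
    obtain ⟨x, hx⟩ :=
      alphaLimit_floor (hloc _ ht) (hclw.contDiff_velocity ht).continuous hc hfl'
    refine ⟨(Real.exp (-s / 2))⁻¹ • x, ?_⟩
    rw [lerayOrbit_apply, smul_smul, mul_inv_cancel₀ hc.ne', one_smul, norm_smul,
      Real.norm_of_nonneg hc.le]
    exact hx
  · -- uniform convergence on the similarity compact `[-R, R] × B̄(0, R)`: it lands in one slab piece
    obtain ⟨m, hm⟩ := exists_nat_ge (Real.exp R + Real.exp (R / 2) * R)
    refine Metric.tendstoUniformlyOn_iff.2 fun ε hε => ?_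
    have hεR : 0 < ε / Real.exp (R / 2) := div_pos hε (Real.exp_pos _)
    filter_upwards [(Metric.tendstoUniformlyOn_iff.1 (hunif m)) _ hεR] with j hj
    rintro ⟨s, y⟩ ⟨hs, hy⟩
    have hd := hj _ (limitClosed_window hs hy hm)
    simp only [Function.uncurry_apply_pair] at hd ⊢
    rw [hdict (φ j) s y, lerayOrbit_apply, dist_smul₀, Real.norm_of_nonneg (Real.exp_pos _).le]
    have hes : Real.exp (-s / 2) ≤ Real.exp (R / 2) := Real.exp_le_exp.2 (by linarith [hs.1])
    refine (mul_lt_mul_of_pos_left hd (Real.exp_pos _)).trans_le ?_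
    calc Real.exp (-s / 2) * (ε / Real.exp (R / 2))
        ≤ Real.exp (R / 2) * (ε / Real.exp (R / 2)) := mul_le_mul_of_nonneg_right hes hεR.le
      _ = ε := by field_simp

end Summit.NavierStokesRegularity.NavierStokesRegularity.Theorems.NoSelfExcitedDynamo.Registered

end
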